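import Literature.FieldTheory.ArtinSchreier.CyclicDegreeP
import Mathlib.FieldTheory.PrimitiveElement
import Mathlib.RingTheory.IsAdjoinRoot
import HarnessLib

/-!
# Rescaled Artin–Schreier and `p`-th-root generators: the polynomials `X^p − g^{p−1}X + f`

Topic `FieldTheory/ArtinSchreier`; sequel of `CyclicDegreeP` (Lang, *Algebra*, VI §6, Thm. 6.4 (i):
a Galois extension `L/K` of degree `p = char K` is `K(ϑ)` with `ϑ^p − ϑ = a ∈ K`). The
valuation-theoretic literature does not use the normalised generator `ϑ` but a RESCALED one:
Cossart–Piltant, *Resolution of singularities of threefolds in positive characteristic I*,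
J. Algebra 320 (2008), Thm 7.2 (HAL pp. 19–21) work with "`h := X^p − g^{p−1}X + f ∈ R[X]`,
`f, g ∈ m_R` (`g ≠ 0` if `k` is perfect)", which covers BOTH the Galois case (`g ≠ 0`: for
`θ := g·ϑ` one has `θ^p − g^{p−1}θ − g^p a = 0`) and the purely inseparable case (`g = 0`:
`h = X^p + f`, a `p`-th root). This file packages, in exactly that syntactic form, what a consumer
needs to know about the rescaled generator `θ`: `K(θ) = L`, the minimal polynomial of `θ` is `h`,
`h` is irreducible, and `L ≅ K[X]/(h)` (`IsAdjoinRoot L h`).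

## Content (everything PROVED)

* `minpoly_eq_of_adjoin_eq_top`, `irreducible_of_adjoin_eq_top`,
  `nonempty_isAdjoinRoot_of_adjoin_eq_top` — a primitive element `θ` of a finite extension `L/K`
  and a monic `q ∈ K[X]` of degree `[L:K]` with `q(θ) = 0`: `q = minpoly_K θ`, `q` is
  irreducible, `L ≅ K[X]/(q)`;
* `adjoin_simple_mul_eq_top` — `K(c·θ) = K(θ)` for `c ∈ K^×`;
* `monic_and_natDegree_rescaledPoly` — `X^p − uX + f` is monic of degree `p` (`p > 1`);
* `aeval_rescaled_artinSchreier`, `rescaled_artinSchreier_generator`,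
  `exists_rescaled_artinSchreier_generator` — **Galois case**: for `L/K` Galois of degree
  `p = char K` and every `g ∈ K^×` there is a generator `θ` of `L/K` with minimal polynomial
  `X^p − g^{p−1}X − g^p a` (`a = ϑ^p − ϑ`), irreducible, `L ≅ K[X]/(X^p − g^{p−1}X − g^p a)`;
* `aeval_rescaled_pthRoot`, `rescaled_pthRoot_generator` — **purely inseparable case**: if
  `L = K(η)`, `η^p = b ∈ K`, `[L:K] = p`, then for every `c ∈ K^×`, `θ := c·η` generates `L/K` with
  minimal polynomial `X^p − 0^{p−1}X − c^p b` (i.e. `X^p − c^p b`), irreducible, `L ≅ K[X]/(h)`.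

The consumer (`Literature/AlgebraicGeometry/CossartPiltant200819/GaloisTower2008.lean`) chooses
`g`, resp. `c`, in the maximal ideal of a local ring `R ⊆ K` with enough denominators to put the
constant coefficient into `m_R` as well.

## References

* S. Lang, *Algebra*, rev. 3rd ed., GTM 211, Springer 2002, Ch. VI §6, Thm. 6.4. [Lang2002]
* V. Cossart, O. Piltant, J. Algebra 320 (2008) 1051–1082 = HAL hal-00139124, Thm 7.2 and its proof
  (pp. 19–21 of the HAL version). [CossartPiltant2008]
-/

namespace Literature.FieldTheory.ArtinSchreier

open Polynomial
-- `_root_`: `CyclicDegreeP` declares a decl in the sub-namespace `…ArtinSchreier.IntermediateField`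
open _root_.IntermediateField

universe u v

variable {K : Type u} {L : Type v} [Field K] [Field L] [Algebra K L]

/-! ### Primitive elements with a prescribed monic relation -/

/-- If `θ` generates the finite extension `L/K` and `q ∈ K[X]` is monic of degree `[L:K]` with
`q(θ) = 0`, then `q` is the minimal polynomial of `θ` (`minpoly ∣ q`, both monic of the same
degree, `deg minpoly = [K(θ):K] = [L:K]`). [folklore] -/
theorem minpoly_eq_of_adjoin_eq_top [FiniteDimensional K L] {θ : L} (hθ : K⟮θ⟯ = ⊤) {q : K[X]}
    (hq : q.Monic) (hdeg : q.natDegree = Module.finrank K L) (hroot : aeval θ q = 0) :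
    minpoly K θ = q := by
  have hint : IsIntegral K θ := IsIntegral.of_finite K θ
  refine (Polynomial.eq_of_monic_of_dvd_of_natDegree_le (minpoly.monic hint) hq
    (minpoly.dvd K θ hroot) ?_).symm
  rw [hdeg, ← (Field.primitive_element_iff_minpoly_natDegree_eq K θ).mp hθ]

/-- Under the hypotheses of `minpoly_eq_of_adjoin_eq_top`: `q` is irreducible. [folklore] -/
theorem irreducible_of_adjoin_eq_top [FiniteDimensional K L] {θ : L} (hθ : K⟮θ⟯ = ⊤) {q : K[X]}
    (hq : q.Monic) (hdeg : q.natDegree = Module.finrank K L) (hroot : aeval θ q = 0) :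
    Irreducible q := by
  rw [← minpoly_eq_of_adjoin_eq_top hθ hq hdeg hroot]
  exact minpoly.irreducible (IsIntegral.of_finite K θ)

/-- Under the hypotheses of `minpoly_eq_of_adjoin_eq_top`: `L ≅ K[X]/(q)`, i.e. `L` is obtained by
adjoining a root of `q` to `K` (`IsAdjoinRoot L q`, through
`K[X]/(minpoly) ≃ K(θ) = ⊤ ≃ L`). [folklore] -/
theorem nonempty_isAdjoinRoot_of_adjoin_eq_top [FiniteDimensional K L] {θ : L} (hθ : K⟮θ⟯ = ⊤)
    {q : K[X]} (hq : q.Monic) (hdeg : q.natDegree = Module.finrank K L) (hroot : aeval θ q = 0) :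
    Nonempty (IsAdjoinRoot L q) := by
  have hint : IsIntegral K θ := IsIntegral.of_finite K θ
  rw [← minpoly_eq_of_adjoin_eq_top hθ hq hdeg hroot]
  exact ⟨IsAdjoinRoot.ofAdjoinRootEquiv
    ((adjoinRootEquivAdjoin K hint).trans ((equivOfEq hθ).trans topEquiv))⟩

/-- Rescaling a primitive element by a non-zero scalar keeps it primitive: `K(c·θ) = L` if
`K(θ) = L` and `c ∈ K^×`. [folklore] -/
theorem adjoin_simple_mul_eq_top {θ : L} (hθ : K⟮θ⟯ = ⊤) {c : K} (hc : c ≠ 0) :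
    K⟮algebraMap K L c * θ⟯ = ⊤ := by
  apply le_antisymm le_top
  rw [← hθ, adjoin_simple_le_iff]
  have h1 : algebraMap K L c * θ ∈ K⟮algebraMap K L c * θ⟯ := mem_adjoin_simple_self K _
  have h2 : (algebraMap K L c)⁻¹ ∈ K⟮algebraMap K L c * θ⟯ :=
    inv_mem (IntermediateField.algebraMap_mem _ c)
  have h3 := mul_mem h2 h1
  rwa [← mul_assoc, inv_mul_cancel₀ ((_root_.map_ne_zero _).mpr hc), one_mul] at h3

/-! ### The polynomials `X^p − uX + f` -/

/-- `X^p − uX + f ∈ K[X]` is monic of degree `p` when `p > 1` (Cossart–Piltant's `h`, with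
`u = g^{p−1}`). [folklore] -/
theorem monic_and_natDegree_rescaledPoly {p : ℕ} (hp : 1 < p) (u f : K) :
    (X ^ p - C u * X + C f : K[X]).Monic ∧ (X ^ p - C u * X + C f : K[X]).natDegree = p := by
  have hlt : (C u * X : K[X]).degree < (X ^ p : K[X]).degree := by
    rw [degree_X_pow]
    exact (degree_C_mul_X_le u).trans_lt (by exact_mod_cast hp)
  have hm1 : (X ^ p - C u * X : K[X]).Monic := (monic_X_pow p).sub_of_left hlt
  have hd1 : (X ^ p - C u * X : K[X]).degree = p := by
    rw [degree_sub_eq_left_of_degree_lt hlt, degree_X_pow]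
  have hlt2 : (C f : K[X]).degree < (X ^ p - C u * X : K[X]).degree := by
    rw [hd1]
    exact degree_C_le.trans_lt (by exact_mod_cast zero_lt_one.trans hp)
  refine ⟨hm1.add_of_left hlt2, ?_⟩
  have h := degree_add_eq_left_of_degree_lt hlt2
  rw [hd1] at h
  exact natDegree_eq_of_degree_eq_some h

/-! ### Galois case: rescaling the Artin–Schreier generator -/

/-- If `ϑ^p − ϑ = a`, then `θ := g·ϑ` is a root of `X^p − g^{p−1}X − g^p a`:
`θ^p = g^p(ϑ + a) = g^{p−1}θ + g^p a`. [cite: CossartPiltant2008, Thm 7.2 proof (HAL pp. 20–21)] -/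
theorem aeval_rescaled_artinSchreier {p : ℕ} (hp : p ≠ 0) {ϑ : L} {a : K}
    (h : ϑ ^ p - ϑ = algebraMap K L a) (g : K) :
    aeval (algebraMap K L g * ϑ) (X ^ p - C (g ^ (p - 1)) * X + C (-(g ^ p * a)) : K[X]) = 0 := by
  have key : algebraMap K L g ^ (p - 1) * algebraMap K L g = algebraMap K L g ^ p :=
    pow_sub_one_mul hp _
  simp only [map_add, map_sub, map_mul, map_neg, map_pow, aeval_X, aeval_C, mul_pow]
  linear_combination (algebraMap K L g) ^ p * h - ϑ * key

/-- **Rescaled Artin–Schreier generator.** Let `[L:K] = p` be prime, `ϑ ∈ L` with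
`ϑ^p − ϑ = a ∈ K` and `K(ϑ) = L`, and `g ∈ K^×`. Then `θ := g·ϑ` generates `L/K`, its minimal
polynomial is `h := X^p − g^{p−1}X − g^p a`, `h` is irreducible and `L ≅ K[X]/(h)`.
[cite: CossartPiltant2008, Thm 7.2 proof (HAL pp. 20–21)] -/
theorem rescaled_artinSchreier_generator {p : ℕ} [Fact p.Prime] [FiniteDimensional K L]
    (hdeg : Module.finrank K L = p) {ϑ : L} {a : K} (h : ϑ ^ p - ϑ = algebraMap K L a)
    (hϑ : K⟮ϑ⟯ = ⊤) {g : K} (hg : g ≠ 0) :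
    K⟮algebraMap K L g * ϑ⟯ = ⊤ ∧
      minpoly K (algebraMap K L g * ϑ) = X ^ p - C (g ^ (p - 1)) * X + C (-(g ^ p * a)) ∧
      Irreducible (X ^ p - C (g ^ (p - 1)) * X + C (-(g ^ p * a)) : K[X]) ∧
      Nonempty (IsAdjoinRoot L (X ^ p - C (g ^ (p - 1)) * X + C (-(g ^ p * a)) : K[X])) := by
  have hp : p.Prime := Fact.out
  have htop := adjoin_simple_mul_eq_top hϑ hg
  obtain ⟨hq, hqd⟩ :=
    monic_and_natDegree_rescaledPoly (K := K) hp.one_lt (g ^ (p - 1)) (-(g ^ p * a))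
  have hpd : (X ^ p - C (g ^ (p - 1)) * X + C (-(g ^ p * a)) : K[X]).natDegree =
      Module.finrank K L := hqd.trans hdeg.symm
  have hroot := aeval_rescaled_artinSchreier hp.ne_zero h g
  exact ⟨htop, minpoly_eq_of_adjoin_eq_top htop hq hpd hroot,
    irreducible_of_adjoin_eq_top htop hq hpd hroot,
    nonempty_isAdjoinRoot_of_adjoin_eq_top htop hq hpd hroot⟩

/-- **Artin–Schreier with an arbitrary rescaling** (Lang VI Thm. 6.4 (i) +
`rescaled_artinSchreier_generator`): for `L/K` Galois of degree `p = char K` there are `ϑ ∈ L`,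
`a ∈ K` with `ϑ^p − ϑ = a`, `K(ϑ) = L`, and for EVERY `g ∈ K^×` the element `g·ϑ` generates `L/K`,
`h_g := X^p − g^{p−1}X − g^p a` is irreducible and `L ≅ K[X]/(h_g)` — the form in which the
hypothesis of Cossart–Piltant 2008 Thm 7.2 consumes a Galois extension of degree `p`.
[cite: Lang2002, Ch. VI §6 Thm. 6.4] -/
theorem exists_rescaled_artinSchreier_generator (p : ℕ) [Fact p.Prime] [CharP K p]
    [FiniteDimensional K L] [IsGalois K L] (hdeg : Module.finrank K L = p) :
    ∃ (ϑ : L) (a : K), ϑ ^ p - ϑ = algebraMap K L a ∧ K⟮ϑ⟯ = ⊤ ∧ ∀ g : K, g ≠ 0 →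
      K⟮algebraMap K L g * ϑ⟯ = ⊤ ∧
        Irreducible (X ^ p - C (g ^ (p - 1)) * X + C (-(g ^ p * a)) : K[X]) ∧
        Nonempty (IsAdjoinRoot L (X ^ p - C (g ^ (p - 1)) * X + C (-(g ^ p * a)) : K[X])) := by
  obtain ⟨ϑ, ⟨a, ha⟩, htop, -⟩ := exists_generator_pow_sub_self_mem (F := K) (E := L) hdeg
  refine ⟨ϑ, a, ha.symm, htop, fun g hg => ?_⟩
  obtain ⟨h1, -, h3, h4⟩ := rescaled_artinSchreier_generator hdeg ha.symm htop hg
  exact ⟨h1, h3, h4⟩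

/-! ### Purely inseparable case: rescaling a `p`-th root -/

/-- If `η^p = b`, then `θ := c·η` is a root of `X^p − 0^{p−1}X − c^p b` (`= X^p − c^p b`, written in
Cossart–Piltant's form `X^p − g^{p−1}X + f` with `g = 0`).
[cite: CossartPiltant2008, Thm 7.2 proof (HAL p. 20, "g := 0, f := −η^p")] -/
theorem aeval_rescaled_pthRoot {p : ℕ} (hp : 1 < p) {η : L} {b : K}
    (hη : η ^ p = algebraMap K L b) (c : K) :
    aeval (algebraMap K L c * η) (X ^ p - C ((0 : K) ^ (p - 1)) * X + C (-(c ^ p * b)) : K[X])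
      = 0 := by
  have hp1 : p - 1 ≠ 0 := Nat.sub_ne_zero_of_lt hp
  simp only [zero_pow hp1, C_0, zero_mul, sub_zero, map_add, map_mul, map_neg, map_pow, aeval_X,
    aeval_C, mul_pow]
  linear_combination (algebraMap K L c) ^ p * hη

/-- **Rescaled `p`-th-root generator.** Let `[L:K] = p` be prime, `η ∈ L` with `η^p = b ∈ K` and
`K(η) = L` (a purely inseparable extension of degree `p`), and `c ∈ K^×`. Then `θ := c·η`
generates `L/K`, its minimal polynomial is `h := X^p − 0^{p−1}X − c^p b`, `h` is irreducible and
`L ≅ K[X]/(h)`. [cite: CossartPiltant2008, Thm 7.2 proof (HAL p. 20, "g := 0, f := −η^p")] -/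
theorem rescaled_pthRoot_generator {p : ℕ} [Fact p.Prime] [FiniteDimensional K L]
    (hdeg : Module.finrank K L = p) {η : L} {b : K} (hη : η ^ p = algebraMap K L b)
    (hη' : K⟮η⟯ = ⊤) {c : K} (hc : c ≠ 0) :
    K⟮algebraMap K L c * η⟯ = ⊤ ∧
      minpoly K (algebraMap K L c * η) = X ^ p - C ((0 : K) ^ (p - 1)) * X + C (-(c ^ p * b)) ∧
      Irreducible (X ^ p - C ((0 : K) ^ (p - 1)) * X + C (-(c ^ p * b)) : K[X]) ∧
      Nonempty (IsAdjoinRoot L (X ^ p - C ((0 : K) ^ (p - 1)) * X + C (-(c ^ p * b)) : K[X])) := by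
  have hp : p.Prime := Fact.out
  have htop := adjoin_simple_mul_eq_top hη' hc
  obtain ⟨hq, hqd⟩ :=
    monic_and_natDegree_rescaledPoly (K := K) hp.one_lt ((0 : K) ^ (p - 1)) (-(c ^ p * b))
  have hpd : (X ^ p - C ((0 : K) ^ (p - 1)) * X + C (-(c ^ p * b)) : K[X]).natDegree =
      Module.finrank K L := hqd.trans hdeg.symm
  have hroot := aeval_rescaled_pthRoot hp.one_lt hη c
  exact ⟨htop, minpoly_eq_of_adjoin_eq_top htop hq hpd hroot,
    irreducible_of_adjoin_eq_top htop hq hpd hroot,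
    nonempty_isAdjoinRoot_of_adjoin_eq_top htop hq hpd hroot⟩

end Literature.FieldTheory.ArtinSchreier
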